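import Mathlib
import HarnessLib.Audit
import Summits.PneNP.PneNP.Theorems.PstarChordReadLemma
import Summits.PneNP.PneNP.Theorems.PstarFreshEraseGates

/-!
# Two chord-local readings trivialise a reader; switch variables; the uniform-type kills (ROUND-24, O1 at exact tightness; memo §6.10 (b)–(d))

FRONTIER range-avoidance ladder, rung F-N3, ROUND 24 (cell `pnp-ideate`, prover-2 memo `g19/O1-CHORD-READ.md` §6.5 (rank-one principle) and §6.10
(b)–(d); referee SCORE 223 Findings A–C; typed target `PstarCoreBoundTargets.TerminalPeelable` (p646951); restricted-model proof complexity — nothing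
here bears on `P` versus `NP`).

After `PstarChordReadLemma` (a slice-generic MONOMIAL-FREE chord kills) and `PstarChordReadFresh` (one fresh single-use gate is erasable), every
slice-generic chord of a terminal configuration carries a gate `(p, z)` whose partner `z` lies outside the core and is a SWITCH: flipping `z` moves the
readers by `(coef₁ z, coef₂ z)`, affine in the core point.  This file proves the instance-level kills of memo §6.10 (b)–(d) in SEMANTIC form (the
switch hypotheses say what flipping `z` does at the solutions of a slice; the gate bookkeeping that produces them is separate):

* `gval_eq_false_of_two_chordLocal` — a reader chord-local at TWO distinct NON-PARALLEL chords is identically `false` (Finding A: parallel chords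
  escape, the hypothesis `hv` excludes them);
* `false_of_gval₂_const` / `false_of_gval₁_const` / `false_of_gval_eq` — a terminal core has no constant reader and no two equal readers (`gSat` +
  feasibility + (M0));
* `gval₂_ne_of_switch₁` — FREE LUNCH: if `z` lies outside the core and is invisible to `Γ₂`, then `Γ₂` fails at every solution where flipping `z`
  moves `Γ₁`;  `xor_gval_of_switch_both` — if flipping `z` moves BOTH readers at a solution, then `Γ₁ ⊕ Γ₂ = b₁ ⊕ b₂ ⊕ 1` there;
* `false_of_typeI` / `false_of_typeII` — TYPE I/II KILL (memo (c), without its case split — Finding B does not arise): two distinct non-parallel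
  slice-generic chords, each with a switch invisible to `Γ₂` that moves `Γ₁` on a whole slice ⟹ `Γ₂` chord-local at both ⟹ `Γ₂` constant ⟹ dead;
* `false_of_typeIII` — TYPE III KILL (memo (d)): two such chords, each with a switch moving BOTH readers on a whole slice ⟹ the SUM reader
  `(C₁ ∆ C₂, G₁ ∆ G₂)` is chord-local at both ⟹ `Γ₁ = Γ₂` as functions ⟹ dead;
* `false_of_independent_switches` — RANK ONE (memo (b)): two outside variables acting AFFINELY on the readers at a solution (moves `dᵢ, dᵢ'`,
  double flip `dᵢ ⊕ dᵢ'`) with INDEPENDENT effect vectors `(d₁,d₂), (d₁',d₂')` hit every target ⟹ ¬(T3).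

Slice genericity (`SliceGeneric`) is used only through `chordLocal_of_fail_slice`, for the reader the slice lemma is applied to.  No Assumption A.
-/

set_option linter.dupNamespace false -- `Summit.PneNP.PneNP.…`: summit = sub-problem name (D-0017 single-conjunct layout)

open Finset Literature.Computability.Complexity
open scoped symmDiff
open Summit.PneNP.PneNP.Theorems.PstarTyped (Typed)
open Summit.PneNP.PneNP.Theorems.PstarSALevel (varSet bdry BoundaryExpanding SimpleOverlap)
open Summit.PneNP.PneNP.Theorems.PstarGapPeeling (eval_update_of_not_mem not_mem_varSet_of_private feasible_of_boundaryExpanding)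
open Summit.PneNP.PneNP.Theorems.PstarCentreFree (vars_mem_varSet)
open Summit.PneNP.PneNP.Theorems.PstarGapOneAll (gval)
open Summit.PneNP.PneNP.Theorems.PstarGConstraint (gval_false gval_update_of_forall_ne)
open Summit.PneNP.PneNP.Theorems.PstarChordRepair (IsChord)
open Summit.PneNP.PneNP.Theorems.PstarCoreBoundTargets (Terminal)
open Summit.PneNP.PneNP.Theorems.PstarGSat (gSat)
open Summit.PneNP.PneNP.Theorems.PstarGSystemFreeVar (gval_symmDiff)
open Summit.PneNP.PneNP.Theorems.PstarFreshErase (slots_ne)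
open Summit.PneNP.PneNP.Theorems.PstarFreshEraseGates (terminal_symm)
open Summit.PneNP.PneNP.Theorems.PstarChordReadLemma (ChordLocal SliceGeneric chordLocal_of_fail_slice)

namespace Summit.PneNP.PneNP.Theorems.PstarChordReadSwitch

variable {n m : ℕ}

/-! ## Two chord-local readings of one reader -/
section TwoLocal

variable {I : LocalMap 4 n m} {J₀ : Finset (Fin m)} {cᵢ cⱼ : Fin m} {C : Finset (Fin n)} {G : Finset (Fin m)}

/-- A variable outside `varSet c` is none of the four variables of `c`. -/
private theorem ne_vars_of_not_mem {u : Fin n} {c : Fin m} (h : u ∉ varSet I c) (s : Fin 4) : u ≠ I.vars c s :=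
  fun e => h (e ▸ vars_mem_varSet I c s)

/-- **A reader chord-local at two distinct non-parallel chords is identically `false`.**  (`hv`: some XOR variable of `cᵢ` is not a variable of
`cⱼ` — the chords are not parallel; Finding A of SCORE 223.) -/
theorem gval_eq_false_of_two_chordLocal (hI : I.IsPure xorAndPred) (hcᵢ : cᵢ ∈ J₀) (hcⱼ : cⱼ ∈ J₀) (hne : cᵢ ≠ cⱼ)
    (hchᵢ : IsChord I J₀ cᵢ) (hv : ∃ s : Fin 4, s.val < 2 ∧ I.vars cᵢ s ∉ varSet I cⱼ)
    (hᵢ : ChordLocal I cᵢ C G) (hⱼ : ChordLocal I cⱼ C G) (x : Fin n → Bool) : gval I C G x = false := by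
  classical
  obtain ⟨φ, hφ⟩ := hᵢ
  obtain ⟨ψ, hψ⟩ := hⱼ
  -- privates of one chord are not variables of the other
  have hpᵢ : I.vars cᵢ 2 ∉ varSet I cⱼ := not_mem_varSet_of_private I hcᵢ hcⱼ hne.symm hchᵢ.1 (vars_mem_varSet I cᵢ 2)
  have hqᵢ : I.vars cᵢ 3 ∉ varSet I cⱼ := not_mem_varSet_of_private I hcᵢ hcⱼ hne.symm hchᵢ.2 (vars_mem_varSet I cᵢ 3)
  -- `ψ`-arguments are unchanged by updating a variable outside `cⱼ`
  have hψu : ∀ (x : Fin n → Bool) (u : Fin n), u ∉ varSet I cⱼ → ∀ b, gval I C G (Function.update x u b) = gval I C G x := by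
    intro x u hu b
    rw [hψ, hψ x, Function.update_of_ne (ne_vars_of_not_mem hu 0).symm, Function.update_of_ne (ne_vars_of_not_mem hu 1).symm,
      Function.update_of_ne (ne_vars_of_not_mem hu 2).symm, Function.update_of_ne (ne_vars_of_not_mem hu 3).symm]
  -- `φ (s, 0, 0) = false` for both `s`: test the zero point and the indicator of the non-parallel XOR variable
  obtain ⟨s, hs, hvs⟩ := hv
  have h01 : I.vars cᵢ 0 ≠ I.vars cᵢ 1 := fun h => absurd (hI.2 cᵢ h) (by decide)
  have hφ0 : ∀ t : Bool, φ t false false = false := by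
    have hz : φ false false false = false := by
      have h := hφ (fun _ => false)
      rw [gval_false] at h
      simpa using h.symm
    have hone : φ true false false = false := by
      -- the indicator of `vars cᵢ s`
      have h := hφ (Function.update (fun _ => false) (I.vars cᵢ s) true)
      rw [hψu _ _ hvs, gval_false] at h
      have hs2 : I.vars cᵢ 2 ≠ I.vars cᵢ s := fun e => by have := hI.2 cᵢ e; subst this; simp at hs
      have hs3 : I.vars cᵢ 3 ≠ I.vars cᵢ s := fun e => by have := hI.2 cᵢ e; subst this; simp at hs
      rw [Function.update_of_ne hs2, Function.update_of_ne hs3] at h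
      have hab : xor (Function.update (fun _ : Fin n => false) (I.vars cᵢ s) true (I.vars cᵢ 0))
          (Function.update (fun _ : Fin n => false) (I.vars cᵢ s) true (I.vars cᵢ 1)) = true := by
        have hs01 : s = 0 ∨ s = 1 := by
          rcases Nat.lt_or_ge s.val 1 with h | h
          · exact Or.inl (Fin.ext (show s.val = 0 by omega))
          · exact Or.inr (Fin.ext (show s.val = 1 by omega))
        rcases hs01 with rfl | rfl
        · rw [Function.update_self, Function.update_of_ne h01.symm]; rfl
        · rw [Function.update_self, Function.update_of_ne h01]; rfl
      rw [hab] at h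
      exact h.symm
    intro t; cases t
    · exact hz
    · exact hone
  -- clear the four privates, then read off `φ`
  have h23 : I.vars cᵢ 2 ≠ I.vars cᵢ 3 := fun h => absurd (hI.2 cᵢ h) (by decide)
  obtain ⟨-, h0p, h0q, h1p, h1q⟩ := slots_ne hI (Or.inl ⟨rfl, rfl⟩ : (I.vars cᵢ 2 = I.vars cᵢ 2 ∧ I.vars cᵢ 3 = I.vars cᵢ 3) ∨ _)
  set x' := Function.update (Function.update x (I.vars cᵢ 2) false) (I.vars cᵢ 3) false with hx'
  have hxx' : gval I C G x = gval I C G x' := by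
    rw [hx', hψu _ _ hqᵢ, hψu _ _ hpᵢ]
  rw [hxx', hφ x', hx', Function.update_self, Function.update_of_ne h23, Function.update_self]
  exact hφ0 _

end TwoLocal

/-! ## Constant readers and equal readers -/
section Const

variable {I : LocalMap 4 n m} {r : ℕ} {y : Fin m → Bool} {J₀ : Finset (Fin m)} {w₁ w₂ : Finset (Fin n) × Finset (Fin m) × Bool}

/-- **A terminal core has no constant second reader.**  If `Γ₂ ≡ b₂` then (T3) says `Γ₁` misses `b₁` on `Sol(J₀)`, so `Γ₁` is constant by `gSat`,
and then (M0) (resp. feasibility of `J₀`) is contradicted; if `Γ₂ ≡ ¬b₂` then (M0) fails at once. -/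
theorem false_of_gval₂_const (hI : I.IsPure xorAndPred) (hT : Typed I) (hS : SimpleOverlap I) (hB : BoundaryExpanding r I)
    (ht : Terminal I r y J₀ w₁ w₂) (h₂ : ∀ x x' : Fin n → Bool, gval I w₂.1 w₂.2.1 x = gval I w₂.1 w₂.2.1 x') : False := by
  obtain ⟨hne, -, hJr, hdj₁, -, -, hT3, hM0⟩ := ht
  obtain ⟨f, hf⟩ := hne
  obtain ⟨z, -, hz₁, hz₂⟩ := hM0 f hf
  -- `Γ₂ ≡ b₂`; so `Γ₁` misses `b₁` on `Sol(J₀)`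
  have hmiss : ∀ x : Fin n → Bool, (∀ j ∈ J₀, I.eval x j = y j) → gval I w₁.1 w₁.2.1 x ≠ w₁.2.2 :=
    fun x hx h₁ => hT3 ⟨x, hx, h₁, by rw [h₂ x z]; exact hz₂⟩
  by_cases hnc : ∃ u u' : Fin n → Bool, gval I w₁.1 w₁.2.1 u ≠ gval I w₁.1 w₁.2.1 u'
  · obtain ⟨x, hx, hx₁⟩ := gSat n m r I hI hT hB hS y J₀ w₁.2.1 w₁.1 w₁.2.2 hJr.le hdj₁ hnc
    exact hmiss x hx hx₁
  · push Not at hnc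
    obtain ⟨x, hx⟩ := feasible_of_boundaryExpanding I hI hB y J₀ hJr.le
    exact hmiss x hx (by rw [hnc x z]; exact hz₁)

/-- **… and no constant first reader.** -/
theorem false_of_gval₁_const (hI : I.IsPure xorAndPred) (hT : Typed I) (hS : SimpleOverlap I) (hB : BoundaryExpanding r I)
    (ht : Terminal I r y J₀ w₁ w₂) (h₁ : ∀ x x' : Fin n → Bool, gval I w₁.1 w₁.2.1 x = gval I w₁.1 w₁.2.1 x') : False :=
  false_of_gval₂_const hI hT hS hB (terminal_symm ht) h₁

/-- **A terminal core has no two EQUAL readers** (`Γ₁ = Γ₂` as functions): if `b₁ ≠ b₂` (M0) fails; if `b₁ = b₂` (T3) says `Γ₁` misses `b₁` on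
`Sol(J₀)`, constant by `gSat`, contradiction as above. -/
theorem false_of_gval_eq (hI : I.IsPure xorAndPred) (hT : Typed I) (hS : SimpleOverlap I) (hB : BoundaryExpanding r I)
    (ht : Terminal I r y J₀ w₁ w₂) (h : ∀ x : Fin n → Bool, gval I w₁.1 w₁.2.1 x = gval I w₂.1 w₂.2.1 x) : False := by
  obtain ⟨hne, -, hJr, hdj₁, -, -, hT3, hM0⟩ := ht
  obtain ⟨f, hf⟩ := hne
  obtain ⟨z, -, hz₁, hz₂⟩ := hM0 f hf
  have hb : w₁.2.2 = w₂.2.2 := by rw [← hz₁, ← hz₂, h z]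
  have hmiss : ∀ x : Fin n → Bool, (∀ j ∈ J₀, I.eval x j = y j) → gval I w₁.1 w₁.2.1 x ≠ w₁.2.2 :=
    fun x hx h₁ => hT3 ⟨x, hx, h₁, by rw [← h x, h₁, hb]⟩
  by_cases hnc : ∃ u u' : Fin n → Bool, gval I w₁.1 w₁.2.1 u ≠ gval I w₁.1 w₁.2.1 u'
  · obtain ⟨x, hx, hx₁⟩ := gSat n m r I hI hT hB hS y J₀ w₁.2.1 w₁.1 w₁.2.2 hJr.le hdj₁ hnc
    exact hmiss x hx hx₁
  · push Not at hnc
    obtain ⟨x, hx⟩ := feasible_of_boundaryExpanding I hI hB y J₀ hJr.le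
    exact hmiss x hx (by rw [hnc x z]; exact hz₁)

end Const

/-! ## Switch variables -/
section Switch

variable {I : LocalMap 4 n m} {r : ℕ} {y : Fin m → Bool} {J₀ : Finset (Fin m)} {w₁ w₂ : Finset (Fin n) × Finset (Fin m) × Bool} {z : Fin n}

/-- Flipping a variable outside the core keeps every solution of the core. -/
theorem solves_update_of_outside (hz : ∀ j ∈ J₀, z ∉ varSet I j) {x : Fin n → Bool} (hx : ∀ j ∈ J₀, I.eval x j = y j) (b : Bool) :
    ∀ j ∈ J₀, I.eval (Function.update x z b) j = y j :=
  fun j hj => by rw [eval_update_of_not_mem I j x (hz j hj) b]; exact hx j hj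

/-- **FREE LUNCH.**  If `z` lies outside the core and is INVISIBLE to `Γ₂` (not in `C₂`, in no monomial of `Γ₂`), then `Γ₂` fails at every solution of
the core at which flipping `z` moves `Γ₁` (one of the two points satisfies `Γ₁`; (T3) there; `Γ₂` is the same at both). -/
theorem gval₂_ne_of_switch₁ (ht : Terminal I r y J₀ w₁ w₂) (hz : ∀ j ∈ J₀, z ∉ varSet I j) (hzC : z ∉ w₂.1)
    (hzG : ∀ g ∈ w₂.2.1, I.vars g 2 ≠ z ∧ I.vars g 3 ≠ z) {x : Fin n → Bool} (hx : ∀ j ∈ J₀, I.eval x j = y j)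
    (hmove : gval I w₁.1 w₁.2.1 (Function.update x z (!x z)) ≠ gval I w₁.1 w₁.2.1 x) : gval I w₂.1 w₂.2.1 x ≠ w₂.2.2 := by
  intro h₂
  have hx' := solves_update_of_outside hz hx (!x z)
  have h₂' : gval I w₂.1 w₂.2.1 (Function.update x z (!x z)) = w₂.2.2 := by rw [gval_update_of_forall_ne I x hzC hzG]; exact h₂
  by_cases h₁ : gval I w₁.1 w₁.2.1 x = w₁.2.2
  · exact ht.2.2.2.2.2.2.1 ⟨x, hx, h₁, h₂⟩
  · refine ht.2.2.2.2.2.2.1 ⟨_, hx', ?_, h₂'⟩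
    revert h₁ hmove
    cases gval I w₁.1 w₁.2.1 (Function.update x z (!x z)) <;> cases gval I w₁.1 w₁.2.1 x <;> cases w₁.2.2 <;> decide

/-- The mirror image: `z` invisible to `Γ₁`, moving `Γ₂`. -/
theorem gval₁_ne_of_switch₂ (ht : Terminal I r y J₀ w₁ w₂) (hz : ∀ j ∈ J₀, z ∉ varSet I j) (hzC : z ∉ w₁.1)
    (hzG : ∀ g ∈ w₁.2.1, I.vars g 2 ≠ z ∧ I.vars g 3 ≠ z) {x : Fin n → Bool} (hx : ∀ j ∈ J₀, I.eval x j = y j)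
    (hmove : gval I w₂.1 w₂.2.1 (Function.update x z (!x z)) ≠ gval I w₂.1 w₂.2.1 x) : gval I w₁.1 w₁.2.1 x ≠ w₁.2.2 :=
  gval₂_ne_of_switch₁ (terminal_symm ht) hz hzC hzG hx hmove

/-- **COMMON SWITCH.**  If flipping the outside variable `z` moves BOTH readers at a solution of the core, then `Γ₁ ⊕ Γ₂ = b₁ ⊕ b₂ ⊕ 1` there
((T3) at the point and at its flip, whose reader values are the complements). -/
theorem xor_gval_of_switch_both (ht : Terminal I r y J₀ w₁ w₂) (hz : ∀ j ∈ J₀, z ∉ varSet I j) {x : Fin n → Bool}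
    (hx : ∀ j ∈ J₀, I.eval x j = y j) (hmove₁ : gval I w₁.1 w₁.2.1 (Function.update x z (!x z)) ≠ gval I w₁.1 w₁.2.1 x)
    (hmove₂ : gval I w₂.1 w₂.2.1 (Function.update x z (!x z)) ≠ gval I w₂.1 w₂.2.1 x) :
    xor (gval I w₁.1 w₁.2.1 x) (gval I w₂.1 w₂.2.1 x) = !(xor w₁.2.2 w₂.2.2) := by
  have hx' := solves_update_of_outside hz hx (!x z)
  have hA := fun (a : gval I w₁.1 w₁.2.1 x = w₁.2.2) (b : gval I w₂.1 w₂.2.1 x = w₂.2.2) => ht.2.2.2.2.2.2.1 ⟨x, hx, a, b⟩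
  have hB := fun (a : gval I w₁.1 w₁.2.1 (Function.update x z (!x z)) = w₁.2.2)
    (b : gval I w₂.1 w₂.2.1 (Function.update x z (!x z)) = w₂.2.2) => ht.2.2.2.2.2.2.1 ⟨_, hx', a, b⟩
  revert hA hB hmove₁ hmove₂
  cases gval I w₁.1 w₁.2.1 (Function.update x z (!x z)) <;> cases gval I w₁.1 w₁.2.1 x <;> cases w₁.2.2 <;>
    cases gval I w₂.1 w₂.2.1 (Function.update x z (!x z)) <;> cases gval I w₂.1 w₂.2.1 x <;> cases w₂.2.2 <;> decide

end Switch

/-! ## The uniform-type kills -/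
section Kills

variable {I : LocalMap 4 n m} {r : ℕ} {y : Fin m → Bool} {J₀ : Finset (Fin m)} {w₁ w₂ : Finset (Fin n) × Finset (Fin m) × Bool}
  {cᵢ cⱼ : Fin m} {zᵢ zⱼ : Fin n}

/-- **TYPE I KILL** (memo §6.10 (c)).  Two distinct non-parallel chords `cᵢ, cⱼ`, both slice-generic for the menu of `Γ₂` (whose monomials avoid
their privates), each with an outside variable `zᵢ, zⱼ` invisible to `Γ₂` that moves `Γ₁` at EVERY solution of some slice of its chord: then `Γ₂`
fails on both slices (free lunch), is chord-local at both chords (slice lemma), hence constant — impossible. -/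
theorem false_of_typeI (hI : I.IsPure xorAndPred) (hT : Typed I) (hS : SimpleOverlap I) (hB : BoundaryExpanding r I)
    (ht : Terminal I r y J₀ w₁ w₂) (hcᵢ : cᵢ ∈ J₀) (hcⱼ : cⱼ ∈ J₀) (hne : cᵢ ≠ cⱼ) (hchᵢ : IsChord I J₀ cᵢ) (hchⱼ : IsChord I J₀ cⱼ)
    (hv : ∃ s : Fin 4, s.val < 2 ∧ I.vars cᵢ s ∉ varSet I cⱼ)
    (hmonoᵢ : ∀ g ∈ w₂.2.1, (I.vars g 2 ≠ I.vars cᵢ 2 ∧ I.vars g 3 ≠ I.vars cᵢ 2) ∧ (I.vars g 2 ≠ I.vars cᵢ 3 ∧ I.vars g 3 ≠ I.vars cᵢ 3))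
    (hmonoⱼ : ∀ g ∈ w₂.2.1, (I.vars g 2 ≠ I.vars cⱼ 2 ∧ I.vars g 3 ≠ I.vars cⱼ 2) ∧ (I.vars g 2 ≠ I.vars cⱼ 3 ∧ I.vars g 3 ≠ I.vars cⱼ 3))
    (hgenᵢ : SliceGeneric I y J₀ cᵢ w₂.2.1) (hgenⱼ : SliceGeneric I y J₀ cⱼ w₂.2.1)
    (hzᵢ : ∀ j ∈ J₀, zᵢ ∉ varSet I j) (hzᵢC : zᵢ ∉ w₂.1) (hzᵢG : ∀ g ∈ w₂.2.1, I.vars g 2 ≠ zᵢ ∧ I.vars g 3 ≠ zᵢ)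
    (hzⱼ : ∀ j ∈ J₀, zⱼ ∉ varSet I j) (hzⱼC : zⱼ ∉ w₂.1) (hzⱼG : ∀ g ∈ w₂.2.1, I.vars g 2 ≠ zⱼ ∧ I.vars g 3 ≠ zⱼ)
    (πᵢ κᵢ πⱼ κⱼ : Bool)
    (hmoveᵢ : ∀ x : Fin n → Bool, (∀ j ∈ J₀, I.eval x j = y j) → x (I.vars cᵢ 2) = πᵢ → x (I.vars cᵢ 3) = κᵢ →
      gval I w₁.1 w₁.2.1 (Function.update x zᵢ (!x zᵢ)) ≠ gval I w₁.1 w₁.2.1 x)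
    (hmoveⱼ : ∀ x : Fin n → Bool, (∀ j ∈ J₀, I.eval x j = y j) → x (I.vars cⱼ 2) = πⱼ → x (I.vars cⱼ 3) = κⱼ →
      gval I w₁.1 w₁.2.1 (Function.update x zⱼ (!x zⱼ)) ≠ gval I w₁.1 w₁.2.1 x) : False := by
  have hᵢ : ChordLocal I cᵢ w₂.1 w₂.2.1 :=
    chordLocal_of_fail_slice hI hcᵢ hchᵢ hgenᵢ hmonoᵢ (Subset.refl _) πᵢ κᵢ w₂.2.2
      fun x hx hp hq => gval₂_ne_of_switch₁ ht hzᵢ hzᵢC hzᵢG hx (hmoveᵢ x hx hp hq)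
  have hⱼ : ChordLocal I cⱼ w₂.1 w₂.2.1 :=
    chordLocal_of_fail_slice hI hcⱼ hchⱼ hgenⱼ hmonoⱼ (Subset.refl _) πⱼ κⱼ w₂.2.2
      fun x hx hp hq => gval₂_ne_of_switch₁ ht hzⱼ hzⱼC hzⱼG hx (hmoveⱼ x hx hp hq)
  refine false_of_gval₂_const hI hT hS hB ht fun x x' => ?_
  rw [gval_eq_false_of_two_chordLocal hI hcᵢ hcⱼ hne hchᵢ hv hᵢ hⱼ x,
    gval_eq_false_of_two_chordLocal hI hcᵢ hcⱼ hne hchᵢ hv hᵢ hⱼ x']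

/-- **TYPE II KILL**: the same with the readers exchanged. -/
theorem false_of_typeII (hI : I.IsPure xorAndPred) (hT : Typed I) (hS : SimpleOverlap I) (hB : BoundaryExpanding r I)
    (ht : Terminal I r y J₀ w₁ w₂) (hcᵢ : cᵢ ∈ J₀) (hcⱼ : cⱼ ∈ J₀) (hne : cᵢ ≠ cⱼ) (hchᵢ : IsChord I J₀ cᵢ) (hchⱼ : IsChord I J₀ cⱼ)
    (hv : ∃ s : Fin 4, s.val < 2 ∧ I.vars cᵢ s ∉ varSet I cⱼ)
    (hmonoᵢ : ∀ g ∈ w₁.2.1, (I.vars g 2 ≠ I.vars cᵢ 2 ∧ I.vars g 3 ≠ I.vars cᵢ 2) ∧ (I.vars g 2 ≠ I.vars cᵢ 3 ∧ I.vars g 3 ≠ I.vars cᵢ 3))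
    (hmonoⱼ : ∀ g ∈ w₁.2.1, (I.vars g 2 ≠ I.vars cⱼ 2 ∧ I.vars g 3 ≠ I.vars cⱼ 2) ∧ (I.vars g 2 ≠ I.vars cⱼ 3 ∧ I.vars g 3 ≠ I.vars cⱼ 3))
    (hgenᵢ : SliceGeneric I y J₀ cᵢ w₁.2.1) (hgenⱼ : SliceGeneric I y J₀ cⱼ w₁.2.1)
    (hzᵢ : ∀ j ∈ J₀, zᵢ ∉ varSet I j) (hzᵢC : zᵢ ∉ w₁.1) (hzᵢG : ∀ g ∈ w₁.2.1, I.vars g 2 ≠ zᵢ ∧ I.vars g 3 ≠ zᵢ)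
    (hzⱼ : ∀ j ∈ J₀, zⱼ ∉ varSet I j) (hzⱼC : zⱼ ∉ w₁.1) (hzⱼG : ∀ g ∈ w₁.2.1, I.vars g 2 ≠ zⱼ ∧ I.vars g 3 ≠ zⱼ)
    (πᵢ κᵢ πⱼ κⱼ : Bool)
    (hmoveᵢ : ∀ x : Fin n → Bool, (∀ j ∈ J₀, I.eval x j = y j) → x (I.vars cᵢ 2) = πᵢ → x (I.vars cᵢ 3) = κᵢ →
      gval I w₂.1 w₂.2.1 (Function.update x zᵢ (!x zᵢ)) ≠ gval I w₂.1 w₂.2.1 x)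
    (hmoveⱼ : ∀ x : Fin n → Bool, (∀ j ∈ J₀, I.eval x j = y j) → x (I.vars cⱼ 2) = πⱼ → x (I.vars cⱼ 3) = κⱼ →
      gval I w₂.1 w₂.2.1 (Function.update x zⱼ (!x zⱼ)) ≠ gval I w₂.1 w₂.2.1 x) : False :=
  false_of_typeI hI hT hS hB (terminal_symm ht) hcᵢ hcⱼ hne hchᵢ hchⱼ hv hmonoᵢ hmonoⱼ hgenᵢ hgenⱼ hzᵢ hzᵢC hzᵢG hzⱼ hzⱼC hzⱼG
    πᵢ κᵢ πⱼ κⱼ hmoveᵢ hmoveⱼ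

/-- `G₁ ∆ G₂ ⊆ G₁ ∪ G₂`. -/
private theorem symmDiff_subset_union' (G₁ G₂ : Finset (Fin m)) : G₁ ∆ G₂ ⊆ G₁ ∪ G₂ := fun g hg => by
  rcases Finset.mem_symmDiff.1 hg with ⟨h, -⟩ | ⟨h, -⟩
  · exact mem_union_left _ h
  · exact mem_union_right _ h

/-- **TYPE III KILL** (memo §6.10 (d)).  Two distinct non-parallel chords, both slice-generic for the menu `G₁ ∆ G₂` of the SUM reader (whose
monomials avoid their privates — gates lying in both readers cancel), each with an outside variable moving BOTH readers at every solution of some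
slice of its chord: then `Γ₁ ⊕ Γ₂ = b₁ ⊕ b₂ ⊕ 1` on both slices, the sum reader is chord-local at both chords, hence identically `false`, i.e.
`Γ₁ = Γ₂` — impossible. -/
theorem false_of_typeIII (hI : I.IsPure xorAndPred) (hT : Typed I) (hS : SimpleOverlap I) (hB : BoundaryExpanding r I)
    (ht : Terminal I r y J₀ w₁ w₂) (hcᵢ : cᵢ ∈ J₀) (hcⱼ : cⱼ ∈ J₀) (hne : cᵢ ≠ cⱼ) (hchᵢ : IsChord I J₀ cᵢ) (hchⱼ : IsChord I J₀ cⱼ)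
    (hv : ∃ s : Fin 4, s.val < 2 ∧ I.vars cᵢ s ∉ varSet I cⱼ)
    (hmonoᵢ : ∀ g ∈ w₁.2.1 ∆ w₂.2.1, (I.vars g 2 ≠ I.vars cᵢ 2 ∧ I.vars g 3 ≠ I.vars cᵢ 2) ∧ (I.vars g 2 ≠ I.vars cᵢ 3 ∧ I.vars g 3 ≠ I.vars cᵢ 3))
    (hmonoⱼ : ∀ g ∈ w₁.2.1 ∆ w₂.2.1, (I.vars g 2 ≠ I.vars cⱼ 2 ∧ I.vars g 3 ≠ I.vars cⱼ 2) ∧ (I.vars g 2 ≠ I.vars cⱼ 3 ∧ I.vars g 3 ≠ I.vars cⱼ 3))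
    (hgenᵢ : SliceGeneric I y J₀ cᵢ (w₁.2.1 ∆ w₂.2.1)) (hgenⱼ : SliceGeneric I y J₀ cⱼ (w₁.2.1 ∆ w₂.2.1))
    (hzᵢ : ∀ j ∈ J₀, zᵢ ∉ varSet I j) (hzⱼ : ∀ j ∈ J₀, zⱼ ∉ varSet I j) (πᵢ κᵢ πⱼ κⱼ : Bool)
    (hmoveᵢ : ∀ x : Fin n → Bool, (∀ j ∈ J₀, I.eval x j = y j) → x (I.vars cᵢ 2) = πᵢ → x (I.vars cᵢ 3) = κᵢ →
      gval I w₁.1 w₁.2.1 (Function.update x zᵢ (!x zᵢ)) ≠ gval I w₁.1 w₁.2.1 x ∧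
      gval I w₂.1 w₂.2.1 (Function.update x zᵢ (!x zᵢ)) ≠ gval I w₂.1 w₂.2.1 x)
    (hmoveⱼ : ∀ x : Fin n → Bool, (∀ j ∈ J₀, I.eval x j = y j) → x (I.vars cⱼ 2) = πⱼ → x (I.vars cⱼ 3) = κⱼ →
      gval I w₁.1 w₁.2.1 (Function.update x zⱼ (!x zⱼ)) ≠ gval I w₁.1 w₁.2.1 x ∧
      gval I w₂.1 w₂.2.1 (Function.update x zⱼ (!x zⱼ)) ≠ gval I w₂.1 w₂.2.1 x) : False := by
  -- the sum reader fails on both slices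
  have hsum : ∀ {c : Fin m} {z : Fin n} (π κ : Bool), c ∈ J₀ → IsChord I J₀ c →
      (∀ g ∈ w₁.2.1 ∆ w₂.2.1, (I.vars g 2 ≠ I.vars c 2 ∧ I.vars g 3 ≠ I.vars c 2) ∧ (I.vars g 2 ≠ I.vars c 3 ∧ I.vars g 3 ≠ I.vars c 3)) →
      SliceGeneric I y J₀ c (w₁.2.1 ∆ w₂.2.1) → (∀ j ∈ J₀, z ∉ varSet I j) →
      (∀ x : Fin n → Bool, (∀ j ∈ J₀, I.eval x j = y j) → x (I.vars c 2) = π → x (I.vars c 3) = κ →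
        gval I w₁.1 w₁.2.1 (Function.update x z (!x z)) ≠ gval I w₁.1 w₁.2.1 x ∧
        gval I w₂.1 w₂.2.1 (Function.update x z (!x z)) ≠ gval I w₂.1 w₂.2.1 x) →
      ChordLocal I c (w₁.1 ∆ w₂.1) (w₁.2.1 ∆ w₂.2.1) := by
    intro c z π κ hc hch hmono hgen hz hmove
    refine chordLocal_of_fail_slice hI hc hch hgen hmono (Subset.refl _) π κ (xor w₁.2.2 w₂.2.2) fun x hx hp hq h => ?_
    have hm := hmove x hx hp hq
    have hb := xor_gval_of_switch_both ht hz hx hm.1 hm.2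
    rw [gval_symmDiff] at h
    rw [h] at hb
    revert hb; cases w₁.2.2 <;> cases w₂.2.2 <;> decide
  have hᵢ := hsum πᵢ κᵢ hcᵢ hchᵢ hmonoᵢ hgenᵢ hzᵢ hmoveᵢ
  have hⱼ := hsum πⱼ κⱼ hcⱼ hchⱼ hmonoⱼ hgenⱼ hzⱼ hmoveⱼ
  refine false_of_gval_eq hI hT hS hB ht fun x => ?_
  have h := gval_eq_false_of_two_chordLocal hI hcᵢ hcⱼ hne hchᵢ hv hᵢ hⱼ x
  rw [gval_symmDiff] at h
  revert h; cases gval I w₁.1 w₁.2.1 x <;> cases gval I w₂.1 w₂.2.1 x <;> decide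

/-- The affine `2 × 2` fact behind RANK ONE: an affine map `𝔽₂² → 𝔽₂²` with invertible linear part is onto. -/
private theorem affine_hits (g₁ g₂ d₁ d₂ d₁' d₂' b₁ b₂ : Bool) (hdet : (d₁ && d₂') ≠ (d₁' && d₂)) :
    (g₁ = b₁ ∧ g₂ = b₂) ∨ (xor g₁ d₁ = b₁ ∧ xor g₂ d₂ = b₂) ∨ (xor g₁ d₁' = b₁ ∧ xor g₂ d₂' = b₂) ∨
      (xor (xor g₁ d₁) d₁' = b₁ ∧ xor (xor g₂ d₂) d₂' = b₂) := by
  revert g₁ g₂ d₁ d₂ d₁' d₂' b₁ b₂ hdet; decide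

/-- **RANK ONE** (memo §6.10 (b), §6.5).  Two outside variables `z ≠ z'` acting AFFINELY on both readers at a solution `x` of the core (flipping
`z` moves `Γᵢ` by `dᵢ`, flipping `z'` by `dᵢ'`, flipping both by `dᵢ ⊕ dᵢ'` — no monomial contains both) with INDEPENDENT effect vectors
`(d₁, d₂)`, `(d₁', d₂')`: then one of the four flips satisfies both readers — against (T3). -/
theorem false_of_independent_switches (ht : Terminal I r y J₀ w₁ w₂) {z z' : Fin n} (hz : ∀ j ∈ J₀, z ∉ varSet I j)
    (hz' : ∀ j ∈ J₀, z' ∉ varSet I j) {x : Fin n → Bool} (hx : ∀ j ∈ J₀, I.eval x j = y j) (d₁ d₂ d₁' d₂' : Bool)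
    (hz₁ : gval I w₁.1 w₁.2.1 (Function.update x z (!x z)) = xor (gval I w₁.1 w₁.2.1 x) d₁)
    (hz₂ : gval I w₂.1 w₂.2.1 (Function.update x z (!x z)) = xor (gval I w₂.1 w₂.2.1 x) d₂)
    (hz'₁ : gval I w₁.1 w₁.2.1 (Function.update x z' (!x z')) = xor (gval I w₁.1 w₁.2.1 x) d₁')
    (hz'₂ : gval I w₂.1 w₂.2.1 (Function.update x z' (!x z')) = xor (gval I w₂.1 w₂.2.1 x) d₂')
    (hzz'₁ : gval I w₁.1 w₁.2.1 (Function.update (Function.update x z (!x z)) z' (!x z')) = xor (xor (gval I w₁.1 w₁.2.1 x) d₁) d₁')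
    (hzz'₂ : gval I w₂.1 w₂.2.1 (Function.update (Function.update x z (!x z)) z' (!x z')) = xor (xor (gval I w₂.1 w₂.2.1 x) d₂) d₂')
    (hdet : (d₁ && d₂') ≠ (d₁' && d₂)) : False := by
  have hxz := solves_update_of_outside hz hx (!x z)
  have hxz' := solves_update_of_outside hz' hx (!x z')
  have hxzz' : ∀ j ∈ J₀, I.eval (Function.update (Function.update x z (!x z)) z' (!x z')) j = y j :=
    solves_update_of_outside hz' hxz (!x z')
  have T := fun (u : Fin n → Bool) (hu : ∀ j ∈ J₀, I.eval u j = y j) (a : gval I w₁.1 w₁.2.1 u = w₁.2.2)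
    (b : gval I w₂.1 w₂.2.1 u = w₂.2.2) => ht.2.2.2.2.2.2.1 ⟨u, hu, a, b⟩
  rcases affine_hits (gval I w₁.1 w₁.2.1 x) (gval I w₂.1 w₂.2.1 x) d₁ d₂ d₁' d₂' w₁.2.2 w₂.2.2 hdet with
    ⟨h₁, h₂⟩ | ⟨h₁, h₂⟩ | ⟨h₁, h₂⟩ | ⟨h₁, h₂⟩
  · exact T x hx h₁ h₂
  · exact T _ hxz (hz₁.trans h₁) (hz₂.trans h₂)
  · exact T _ hxz' (hz'₁.trans h₁) (hz'₂.trans h₂)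
  · exact T _ hxzz' (hzz'₁.trans h₁) (hzz'₂.trans h₂)

end Kills

end Summit.PneNP.PneNP.Theorems.PstarChordReadSwitch
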